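import Summits.NavierStokesRegularity.NavierStokesRegularity.Theses.AngularGalerkinLadder
import Summits.NavierStokesRegularity.NavierStokesRegularity.Theorems.NoOverheating.Negative.LadderLimitExposed
import Summits.NavierStokesRegularity.NavierStokesRegularity.Theorems.RecurrentProfilesRecurrentLiouvilleLebL3BackwardLiouville
import Mathlib.MeasureTheory.Measure.Lebesgue.EqHaar
import Mathlib.MeasureTheory.Measure.Haar.InnerProductSpace
import Mathlib.MeasureTheory.Function.LpSpace.Complete

/-!
# KJ-43 — window profiles with an `L³` (or finite-energy) slice are excluded
# (Albritton–Barker 2019, Thm 1.2, on the ladder limit: the `L^p`, `p ≤ 3`, corner of K2)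

Refuter lineage, Negative lane of crux K2 `NoOverheating` of route `AngularGalerkinLadder`
(supports, does not decide).  The census (`ExcludedStrataCensusV2`, KJ-38/39/41, KJ-40/42) lists
what an admissible window sequence of K2 cannot be by SYMMETRY (small constant, axisymmetric, fine
factors, screws in Pineau–Vicol's regimes, hidden (R)SS).  This file records the INTEGRABILITY
corner, with its printed criterion:

* `eLpNorm_three_slice_eq_of_isRotatedDSS` (§1): the `L³(ℝ³)` norm of a slice is invariant under
  the rotated Navier–Stokes rescaling — for a `(c, S)`-RDSS field, `‖v(t)‖₃ = ‖v(c²t)‖₃`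
  (`L³` is scaling-critical; rotations preserve Lebesgue measure).
* `no_windowSequence_L3slice` (§2): NO admissible window sequence (constants `1 < cmin`, `0 < δ`,
  `εₙ → 0`, any rotations, Type-I constant `C₀`) has the slices `uₙ(−1)` bounded in `L³(ℝ³)`
  uniformly in `n`: by Fatou the ladder limit `v` (`exists_ladderLimit_typeI`) has `v(−1) ∈ L³`, by
  §1 `‖v(−c'^{2k})‖₃ = ‖v(−1)‖₃` along `−c'^{2k} → −∞` (`c' > 1`), and Albritton–Barker's backward
  `L³` Liouville theorem in the Type-I-rate Oseen-mild class (`lebL3B_liouville_rate`, tree proof of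
  J. Math. Fluid Mech. 21 (2019) Thm 1.2 over KNSS's integral equation) gives `v ≡ 0`, against the
  amplitude floor `δ ≤ ‖v(−1, x)‖`.
* `no_windowSequence_L2slice` (§2): the same with FINITE ENERGY slices, `‖uₙ(−1)‖₂ ≤ M`: the limit
  slice is in `L² ∩ L^∞` (Type I), hence in `L³`.
* §3 reads both on the cruxes: `RungBlowupCofinal` with a `NoOverheating` met by window profiles
  whose slice `u(−1)` has `L³` norm (resp. energy) bounded independently of the rung is contradictory.

This is the window-sequence form of the classical integrability exclusions of self-similar blow-up
(Nečas–Růžička–Šverák 1996: `U ∈ L³`; Tsai 1998: finite local energy), reached for merely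
DISCRETELY self-similar, rotated profiles through Albritton–Barker.  WHAT ESCAPES: the live profiles,
which decay like `C₀/|y|` and have infinite `L³` norm and energy (only weak-`L³`, where Thm 4.1 of
Albritton–Barker needs the extra class `𝔹`, false for DSS profiles).  WHAT THIS IS NOT: not
`¬NoOverheating`; no new Literature fact, no definition; standard axioms only.
[cite: AlbrittonBarker2019, Theorem 1.2 (arXiv:1811.00502 p. 4; proof §4 p. 9)]
[cite: NecasRuzickaSverak1996, Theorem 1] [cite: Tsai1998, Theorem 1]
[cite: KochNadirashviliSereginSverak2009, §4 (i) (the integral equation)] -/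

namespace Summit.NavierStokesRegularity.AngularGalerkinLadderL3SliceWindowsExcluded

open Set Filter MeasureTheory Topology Function
open scoped ENNReal NNReal
open Literature.Analysis Literature.Analysis.FluidPDE
open Summit.NavierStokesRegularity.FluidComputer
open Summit.NavierStokesRegularity.NavierStokesRegularity.Theses.AngularGalerkinLadder
open Summit.NavierStokesRegularity.AngularGalerkinLadderLadderLimit
open Summit.NavierStokesRegularity.NavierStokesRegularity.Theorems

/-! ### §1 `L³(ℝ³)` is invariant under the rotated Navier–Stokes rescaling -/

/-- Dilating the argument by `a > 0` divides the `L³(ℝ³)` norm by `a`: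
`‖f(a ·)‖₃ = a⁻¹ ‖f‖₃` (Lebesgue measure scales by `a³`). [folklore] -/
theorem eLpNorm_three_comp_smul (f : EuclideanSpace ℝ (Fin 3) → EuclideanSpace ℝ (Fin 3))
    {a : ℝ} (ha : 0 < a) :
    eLpNorm (fun x => f (a • x)) 3 volume = ENNReal.ofReal a⁻¹ * eLpNorm f 3 volume := by
  have hemb : MeasurableEmbedding (fun x : EuclideanSpace ℝ (Fin 3) => a • x) :=
    (Homeomorph.smul (Units.mk0 a ha.ne')).measurableEmbedding
  have h0 : ENNReal.ofReal |(a ^ 3)⁻¹| ≠ 0 :=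
    (ENNReal.ofReal_pos.2 (abs_pos.2 (inv_ne_zero (pow_ne_zero _ ha.ne')))).ne'
  rw [← Function.comp_def f, ← hemb.eLpNorm_map_measure, Measure.map_addHaar_smul volume ha.ne',
    finrank_euclideanSpace_fin, eLpNorm_smul_measure_of_ne_zero h0, smul_eq_mul]
  congr 1
  have h13 : (1 / (3 : ℝ≥0∞)).toReal = ((3 : ℕ) : ℝ)⁻¹ := by norm_num
  rw [h13, abs_of_pos (inv_pos.2 (pow_pos ha 3)), ← inv_pow, ENNReal.ofReal_pow (inv_pos.2 ha).le,
    ENNReal.pow_rpow_inv_natCast three_ne_zero]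

/-- **`L³` is invariant under the rotated Navier–Stokes rescaling.**  For a `(c, S)`-RDSS field
(`c > 0`), `‖v(t)‖_{L³(ℝ³)} = ‖v(c²t)‖_{L³(ℝ³)}` for every `t`: `v(t) = c S⁻¹ v(c²t)(c S ·)`, the
isometry `S⁻¹` on values and the measure-preserving `S` on arguments do not change the norm, and the
dilation by `c` costs `c⁻¹`, cancelled by the amplitude `c`. [folklore] -/
theorem eLpNorm_three_slice_eq_of_isRotatedDSS {c : ℝ}
    {S : EuclideanSpace ℝ (Fin 3) ≃ₗᵢ[ℝ] EuclideanSpace ℝ (Fin 3)}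
    {v : ℝ → EuclideanSpace ℝ (Fin 3) → EuclideanSpace ℝ (Fin 3)}
    (h : IsRotatedDSS c S v) (hc : 0 < c) (t : ℝ) :
    eLpNorm (v t) 3 volume = eLpNorm (v (c ^ 2 * t)) 3 volume := by
  have hfun : v t = c • fun x => S.symm (v (c ^ 2 * t) (c • S x)) := by
    funext x
    exact (h t x).symm
  rw [hfun, eLpNorm_const_smul, Real.enorm_eq_ofReal hc.le]
  have h1 : eLpNorm (fun x => S.symm (v (c ^ 2 * t) (c • S x))) 3 volume =
      eLpNorm (fun x => v (c ^ 2 * t) (c • S x)) 3 volume :=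
    eLpNorm_congr_norm_ae (Eventually.of_forall fun x => S.symm.norm_map _)
  have h2 : eLpNorm (fun x => v (c ^ 2 * t) (c • S x)) 3 volume =
      eLpNorm (fun y => v (c ^ 2 * t) (c • y)) 3 volume := by
    have h3 := S.toHomeomorph.measurableEmbedding.eLpNorm_map_measure
      (g := fun y => v (c ^ 2 * t) (c • y)) (p := 3) (μ := volume)
    rw [LinearIsometryEquiv.coe_toHomeomorph, S.measurePreserving.map_eq] at h3
    exact h3.symm
  rw [h1, h2, eLpNorm_three_comp_smul _ hc, ← mul_assoc, ← ENNReal.ofReal_mul hc.le,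
    mul_inv_cancel₀ hc.ne', ENNReal.ofReal_one, one_mul]

/-- Along the backward orbit `tₖ = −c^{2k}` of the rescaling the `L³` norms of the slices of a
`(c, S)`-RDSS field are all equal to `‖v(−1)‖₃`. [folklore] -/
theorem eLpNorm_three_slice_orbit {c : ℝ}
    {S : EuclideanSpace ℝ (Fin 3) ≃ₗᵢ[ℝ] EuclideanSpace ℝ (Fin 3)}
    {v : ℝ → EuclideanSpace ℝ (Fin 3) → EuclideanSpace ℝ (Fin 3)}
    (h : IsRotatedDSS c S v) (hc : 0 < c) (k : ℕ) :
    eLpNorm (v (-(c ^ 2) ^ k)) 3 volume = eLpNorm (v (-1)) 3 volume := by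
  induction k with
  | zero => simp
  | succ k ih =>
    rw [← ih, pow_succ, mul_comm ((c ^ 2) ^ k), ← mul_neg,
      ← eLpNorm_three_slice_eq_of_isRotatedDSS h hc]

/-! ### §2 No admissible window sequence with `L³`-bounded (or energy-bounded) slices -/

/-- **No admissible window sequence has its slices `uₙ(−1)` bounded in `L³(ℝ³)`.**  Constants
`1 < cmin`, `0 < δ`, `εₙ → 0`, any rotations, a window rung profile with Type-I constant `C₀` at
every index, and `‖uₙ(−1)‖_{L³} ≤ M < ∞` for all `n`, are contradictory: the ladder limit `v`
(`exists_ladderLimit_typeI`) has `‖v(−1)‖₃ ≤ M` (Fatou, `eLpNorm_lim_le_liminf_eLpNorm`), hence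
`‖v(−c'^{2k})‖₃ ≤ M` along `−c'^{2k} → −∞` (`eLpNorm_three_slice_orbit`, `c' > 1`), so
Albritton–Barker's backward-`L³` Liouville theorem in the Type-I-rate Oseen-mild class
(`lebL3B_liouville_rate`) gives `v ≡ 0` on the open past, against `δ ≤ ‖v(−1, x)‖`.
[cite: AlbrittonBarker2019, Theorem 1.2 (arXiv:1811.00502 p. 4)]
[cite: NecasRuzickaSverak1996, Theorem 1] -/
theorem no_windowSequence_L3slice {C₀ cmin cmax δ : ℝ} {L : ℕ → ℕ} {ε c : ℕ → ℝ}
    {R : ℕ → (EuclideanSpace ℝ (Fin 3) ≃ₗᵢ[ℝ] EuclideanSpace ℝ (Fin 3))}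
    {u : ℕ → ℝ → EuclideanSpace ℝ (Fin 3) → EuclideanSpace ℝ (Fin 3)}
    {p : ℕ → ℝ → EuclideanSpace ℝ (Fin 3) → ℝ}
    {d : ℕ → ℝ → EuclideanSpace ℝ (Fin 3) → EuclideanSpace ℝ (Fin 3)}
    (hcmin : 1 < cmin) (hδ : 0 < δ) (hε : Tendsto ε atTop (𝓝 0))
    (hW : ∀ n, AngularLadder.IsWindowProfile (L n) C₀ cmin cmax δ (ε n) (c n) (R n) (u n) (p n)
      (d n))
    {M : ℝ≥0∞} (hM : M < ⊤) (hL3 : ∀ n, eLpNorm (u n (-1)) 3 volume ≤ M) : False := by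
  obtain ⟨φ, c', R', v, -, -, -, -, hptw, -, -, hc', hTAM, -, hDSS, -, ⟨x₀, hx₀⟩, -⟩ :=
    exists_ladderLimit_typeI hcmin hδ hε hW
  -- Fatou at `t = -1`
  have hmeasn : ∀ n, AEStronglyMeasurable (u (φ n) (-1)) volume := fun n =>
    (continuous_slice_of_continuousOn_Iio (hW (φ n)).1.classical.smooth_velocity.continuousOn
      (by norm_num : (-1 : ℝ) < 0)).aestronglyMeasurable
  have h3v : eLpNorm (v (-1)) 3 volume ≤ M :=
    (Lp.eLpNorm_lim_le_liminf_eLpNorm hmeasn (v (-1))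
      (Eventually.of_forall fun x => hptw (-1) (by norm_num) x)).trans
      (liminf_le_of_frequently_le' (Frequently.of_forall fun n => hL3 (φ n)))
  -- the backward orbit `τ k = -(c'^2)^k → -∞` carries the same `L³` norm
  have hc'0 : 0 < c' := zero_lt_one.trans hc'
  have hτ : Tendsto (fun k : ℕ => -(c' ^ 2) ^ k) atTop atBot :=
    tendsto_neg_atTop_atBot.comp (tendsto_pow_atTop_atTop_of_one_lt (by nlinarith))
  have hτM : ∀ k : ℕ, eLpNorm (v (-(c' ^ 2) ^ k)) 3 volume ≤ M := fun k =>
    (eLpNorm_three_slice_orbit hDSS hc'0 k).le.trans h3v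
  -- Albritton–Barker 2019, Thm 1.2 (Type-I-rate Oseen-mild class)
  have hzero := lebL3B_liouville_rate hTAM.continuousOn_uncurry (fun t ht => hTAM.isWeaklyDivFree ht)
    (fun s t hst ht x => hTAM.mild_eq_heatExtension hst ht x) hTAM.hasTypeITimeDecay hM hτ hτM
  have h0 := hzero (-1) (by norm_num) x₀
  rw [h0, norm_zero] at hx₀
  exact absurd hx₀ (not_le.2 hδ)

/-- A bounded field with an `L²` slice has that slice in `L³`: `∫ |f|³ ≤ B ∫ |f|²`. [folklore] -/
theorem eLpNorm_three_lt_top_of_two {f : EuclideanSpace ℝ (Fin 3) → EuclideanSpace ℝ (Fin 3)} {B : ℝ}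
    (hB : ∀ x, ‖f x‖ ≤ B) (h2 : eLpNorm f 2 volume < ⊤) : eLpNorm f 3 volume < ⊤ := by
  have hB0 : 0 ≤ B := (norm_nonneg _).trans (hB 0)
  have h2' : ∫⁻ x, ‖f x‖ₑ ^ (2 : ℝ) ∂volume < ⊤ := by
    have := lintegral_rpow_enorm_lt_top_of_eLpNorm_lt_top (p := (2 : ℝ≥0∞)) (by norm_num)
      (by norm_num) h2
    simpa using this
  have hpt : ∀ x, ‖f x‖ₑ ^ (3 : ℝ) ≤ ENNReal.ofReal B * ‖f x‖ₑ ^ (2 : ℝ) := by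
    intro x
    have hsplit : ‖f x‖ₑ ^ (3 : ℝ) = ‖f x‖ₑ * ‖f x‖ₑ ^ (2 : ℝ) := by
      rw [show (3 : ℝ) = 1 + 2 by norm_num, ENNReal.rpow_add_of_nonneg _ _ (by norm_num) (by norm_num),
        ENNReal.rpow_one]
    rw [hsplit]
    gcongr
    rw [← ofReal_norm]
    exact ENNReal.ofReal_le_ofReal (hB x)
  have h3 : ∫⁻ x, ‖f x‖ₑ ^ (3 : ℝ) ∂volume < ⊤ :=
    calc ∫⁻ x, ‖f x‖ₑ ^ (3 : ℝ) ∂volume ≤ ∫⁻ x, ENNReal.ofReal B * ‖f x‖ₑ ^ (2 : ℝ) ∂volume :=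
          lintegral_mono fun x => hpt x
      _ = ENNReal.ofReal B * ∫⁻ x, ‖f x‖ₑ ^ (2 : ℝ) ∂volume := lintegral_const_mul' _ _ ENNReal.ofReal_ne_top
      _ < ⊤ := ENNReal.mul_lt_top ENNReal.ofReal_lt_top h2'
  rw [eLpNorm_eq_lintegral_rpow_enorm_toReal (by norm_num) (by norm_num)]
  simp only [ENNReal.toReal_ofNat]
  exact ENNReal.rpow_lt_top_of_nonneg (by norm_num) h3.ne

/-- **No admissible window sequence has FINITE-ENERGY slices `uₙ(−1)` with energy bounded in `n`.**
As `no_windowSequence_L3slice`: the limit slice `v(−1)` is in `L²` (Fatou) and bounded by `C₀`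
(Type I), hence in `L³` (`eLpNorm_three_lt_top_of_two`); then §1 and Albritton–Barker.
[cite: AlbrittonBarker2019, Theorem 1.2] [cite: Tsai1998, Theorem 1] -/
theorem no_windowSequence_L2slice {C₀ cmin cmax δ : ℝ} {L : ℕ → ℕ} {ε c : ℕ → ℝ}
    {R : ℕ → (EuclideanSpace ℝ (Fin 3) ≃ₗᵢ[ℝ] EuclideanSpace ℝ (Fin 3))}
    {u : ℕ → ℝ → EuclideanSpace ℝ (Fin 3) → EuclideanSpace ℝ (Fin 3)}
    {p : ℕ → ℝ → EuclideanSpace ℝ (Fin 3) → ℝ}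
    {d : ℕ → ℝ → EuclideanSpace ℝ (Fin 3) → EuclideanSpace ℝ (Fin 3)}
    (hcmin : 1 < cmin) (hδ : 0 < δ) (hε : Tendsto ε atTop (𝓝 0))
    (hW : ∀ n, AngularLadder.IsWindowProfile (L n) C₀ cmin cmax δ (ε n) (c n) (R n) (u n) (p n)
      (d n))
    {M : ℝ≥0∞} (hM : M < ⊤) (hL2 : ∀ n, eLpNorm (u n (-1)) 2 volume ≤ M) : False := by
  obtain ⟨φ, c', R', v, -, -, -, -, hptw, -, -, hc', hTAM, -, hDSS, hvTI, ⟨x₀, hx₀⟩, -⟩ :=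
    exists_ladderLimit_typeI hcmin hδ hε hW
  -- Fatou at `t = -1`, in `L²`
  have hmeasn : ∀ n, AEStronglyMeasurable (u (φ n) (-1)) volume := fun n =>
    (continuous_slice_of_continuousOn_Iio (hW (φ n)).1.classical.smooth_velocity.continuousOn
      (by norm_num : (-1 : ℝ) < 0)).aestronglyMeasurable
  have h2v : eLpNorm (v (-1)) 2 volume ≤ M :=
    (Lp.eLpNorm_lim_le_liminf_eLpNorm hmeasn (v (-1))
      (Eventually.of_forall fun x => hptw (-1) (by norm_num) x)).trans
      (liminf_le_of_frequently_le' (Frequently.of_forall fun n => hL2 (φ n)))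
  -- Type I at `t = -1`: `‖v(-1, x)‖ ≤ C₀`, so `v(-1) ∈ L³`
  have hC₀ : 0 ≤ C₀ := by
    have h1 := (norm_nonneg _).trans (hvTI (-1) (by norm_num) 0)
    simpa using h1
  have hbd : ∀ x, ‖v (-1) x‖ ≤ C₀ := fun x => by
    have h := hvTI (-1) (by norm_num) x
    rw [neg_neg, Real.sqrt_one] at h
    exact h.trans (div_le_self hC₀ (by linarith [norm_nonneg x]))
  have h3v : eLpNorm (v (-1)) 3 volume < ⊤ := eLpNorm_three_lt_top_of_two hbd (h2v.trans_lt hM)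
  -- the backward orbit and Albritton–Barker, with the finite bound `‖v(-1)‖₃`
  have hc'0 : 0 < c' := zero_lt_one.trans hc'
  have hτ : Tendsto (fun k : ℕ => -(c' ^ 2) ^ k) atTop atBot :=
    tendsto_neg_atTop_atBot.comp (tendsto_pow_atTop_atTop_of_one_lt (by nlinarith))
  have hτM : ∀ k : ℕ, eLpNorm (v (-(c' ^ 2) ^ k)) 3 volume ≤ eLpNorm (v (-1)) 3 volume := fun k =>
    (eLpNorm_three_slice_orbit hDSS hc'0 k).le
  have hzero := lebL3B_liouville_rate hTAM.continuousOn_uncurry (fun t ht => hTAM.isWeaklyDivFree ht)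
    (fun s t hst ht x => hTAM.mild_eq_heatExtension hst ht x) hTAM.hasTypeITimeDecay h3v hτ hτM
  have h0 := hzero (-1) (by norm_num) x₀
  rw [h0, norm_zero] at hx₀
  exact absurd hx₀ (not_le.2 hδ)

/-! ### §3 Read on the open cruxes -/

/-- **K1 ∧ (K2 met by window profiles with `L³`-bounded slices) is FALSE.**  `RungBlowupCofinal`
and a `NoOverheating`-type supply of window rung profiles (constant `C₀`, window `[cmin, cmax]`,
`1 < cmin`) whose slices `u(−1)` have `L³(ℝ³)` norm bounded independently of the rung are
contradictory. [cite: AlbrittonBarker2019, Theorem 1.2] [cite: NecasRuzickaSverak1996, Theorem 1] -/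
theorem not_cofinal_and_noOverheating_L3slice (C₀ : ℝ) :
    ¬ (RungBlowupCofinal ∧
      ∃ (cmin cmax δ : ℝ) (L₀ : ℕ) (ε : ℕ → ℝ) (M : ℝ≥0∞), 1 < cmin ∧ 0 < δ ∧ M < ⊤ ∧
        Tendsto ε atTop (𝓝 0) ∧
        ∀ L ≥ L₀, AngularLadder.RungIsSingular L →
          ∃ (c : ℝ) (R : EuclideanSpace ℝ (Fin 3) ≃ₗᵢ[ℝ] EuclideanSpace ℝ (Fin 3))
            (u : ℝ → EuclideanSpace ℝ (Fin 3) → EuclideanSpace ℝ (Fin 3))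
            (p : ℝ → EuclideanSpace ℝ (Fin 3) → ℝ)
            (d : ℝ → EuclideanSpace ℝ (Fin 3) → EuclideanSpace ℝ (Fin 3)),
            AngularLadder.IsWindowProfile L C₀ cmin cmax δ (ε L) c R u p d ∧
              eLpNorm (u (-1)) 3 volume ≤ M) := by
  rintro ⟨h₁, cmin, cmax, δ, L₀, ε, M, hcmin, hδ, hM, hε, hwin⟩
  choose L hLge hLsing using fun n : ℕ => h₁ (max L₀ n)
  choose c R u p d hW hL3 using fun n : ℕ =>
    hwin (L n) (le_trans (le_max_left _ _) (hLge n)) (hLsing n)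
  have hε' : Tendsto (fun n : ℕ => ε (L n)) atTop (𝓝 0) :=
    hε.comp (tendsto_atTop_mono (fun n => le_trans (le_max_right _ _) (hLge n)) tendsto_id)
  exact no_windowSequence_L3slice hcmin hδ hε' hW hM hL3

/-- **K1 ∧ (K2 met by window profiles with energy-bounded slices) is FALSE.**
[cite: AlbrittonBarker2019, Theorem 1.2] [cite: Tsai1998, Theorem 1] -/
theorem not_cofinal_and_noOverheating_L2slice (C₀ : ℝ) :
    ¬ (RungBlowupCofinal ∧
      ∃ (cmin cmax δ : ℝ) (L₀ : ℕ) (ε : ℕ → ℝ) (M : ℝ≥0∞), 1 < cmin ∧ 0 < δ ∧ M < ⊤ ∧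
        Tendsto ε atTop (𝓝 0) ∧
        ∀ L ≥ L₀, AngularLadder.RungIsSingular L →
          ∃ (c : ℝ) (R : EuclideanSpace ℝ (Fin 3) ≃ₗᵢ[ℝ] EuclideanSpace ℝ (Fin 3))
            (u : ℝ → EuclideanSpace ℝ (Fin 3) → EuclideanSpace ℝ (Fin 3))
            (p : ℝ → EuclideanSpace ℝ (Fin 3) → ℝ)
            (d : ℝ → EuclideanSpace ℝ (Fin 3) → EuclideanSpace ℝ (Fin 3)),
            AngularLadder.IsWindowProfile L C₀ cmin cmax δ (ε L) c R u p d ∧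
              eLpNorm (u (-1)) 2 volume ≤ M) := by
  rintro ⟨h₁, cmin, cmax, δ, L₀, ε, M, hcmin, hδ, hM, hε, hwin⟩
  choose L hLge hLsing using fun n : ℕ => h₁ (max L₀ n)
  choose c R u p d hW hL2 using fun n : ℕ =>
    hwin (L n) (le_trans (le_max_left _ _) (hLge n)) (hLsing n)
  have hε' : Tendsto (fun n : ℕ => ε (L n)) atTop (𝓝 0) :=
    hε.comp (tendsto_atTop_mono (fun n => le_trans (le_max_right _ _) (hLge n)) tendsto_id)
  exact no_windowSequence_L2slice hcmin hδ hε' hW hM hL2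

end Summit.NavierStokesRegularity.AngularGalerkinLadderL3SliceWindowsExcluded
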